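import Literature.NumberTheory.Automorphic.BockleHuiIrreducibleGL3WeightProofs
import Literature.NumberTheory.Automorphic.PairLFunctionPolesRepDataBoundaryRankOne
import HarnessLib

/-!
# The analytic package of the partial Hecke `L`-function `L^S(s, u)` of a Hecke character unitary
# at almost every place — proofs only

Topic `NumberTheory/Automorphic`; namespace `Literature.NumberTheory.Automorphic`.  PROOFS file
(theorems only: no definition, no named fact, no `sorry`).

For a Hecke character `u` of the idele classes of a number field `F` with `|u(ϖ_w)| = 1` at almost
every finite place `w`, the partial Hecke `L`-function, written as the Rankin–Selberg product on
`GL₁ × GL₁`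
`L^S(s, u) = partialPairL S (w ↦ {u(ϖ_w)}) (w ↦ {1}) s = ∏_{w ∉ S} (1 - u(ϖ_w) q_w^{-s})⁻¹`,
has, for every finite `S` containing a finite `S₀` (depending on `u`), the analytic package
(`analyticPackage_glOne`):

* (2.1) the Euler product is multipliable on `Re s > 1` (Jacquet–Shalika I, Thm. 5.3, the THEOREM
  `JacquetShalika1981_multipliable_partialPairL_repData_holds` in ranks `(1, 1)`);
* it is continuous and non-zero at every point of `Re s > 1`
  (`continuousAt_and_ne_zero_partialPairL_repData`);
* (2.3) if `u(ϖ_w) = 1` for almost all `w` — then, `S₀` containing the exceptional places, the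
  product IS the partial Dedekind zeta function `ζ_F^S` — a simple pole at `s = 1`:
  `(s - 1) L^S(s, u) → c ≠ 0` as `s → 1`, `Re s > 1` (Hecke; `tendsto_sub_one_mul_partialPairL_one_one`,
  on Mathlib's residue of the Dedekind zeta function);
* (2.2) otherwise a finite NON-ZERO limit as `s → 1`, `Re s > 1` (the THEOREM
  `JacquetShalika1981_partialPairL_boundary_repData_one_one`: Hecke–Landau non-vanishing
  `L^S(1, u) ≠ 0` for unitary `u ≠ 1`).

The `GL₁` cuspidal data carrying the Satake families `{u(ϖ_w)}` and `{1}` are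
`exists_cuspidal_glOne_hasSatakeParamAt_valueAtUniformizer` and
`exists_cuspidal_glOne_hasSatakeParamAt_one` (Borel–Jacquet 1979, 4.6).  Everything used is a
theorem of the tree: the package is UNCONDITIONAL.  Not here: anything about `GL_n × GL_m` with
`n m > 1` (conditional on the named facts (2.2)/(2.3) for Borel–Jacquet data).

## References

* J. Arthur, L. Clozel, *Simple algebras, base change, and the advanced theory of the trace
  formula*, Ann. of Math. Stud. 120 (1989), Ch. 3 §2, (2.1)–(2.3). [ArthurClozelAMS120]
* J. Neukirch, *Algebraic Number Theory*, Grundlehren 322 (1999), Ch. VII, Cor. (5.11) (ii).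
  [NeukirchANT1999]
* H. Jacquet, J. A. Shalika, Amer. J. Math. 103 (1981), I Thm. (5.3); II Prop. 3.6.
  [JacquetShalikaAJM1981] [JacquetShalikaAJM1981II]
-/

noncomputable section

open scoped MatrixGroups Topology Classical NumberField
open NumberField IsDedekindDomain Filter Polynomial

namespace Literature.NumberTheory.Automorphic

open Literature.NumberTheory.GaloisRepresentations (HeckeCharacter)

/-- **The analytic package of `L^S(s, u)` for a Hecke character `u` unitary at almost every place**
(`GL₁ × GL₁`, all inputs THEOREMS of the tree).  There is a finite `S₀` such that for every finite
`S ⊇ S₀` the Euler product `L^S(s, u) = ∏_{w ∉ S} (1 - u(ϖ_w) q_w^{-s})⁻¹ =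
partialPairL S (w ↦ {u(ϖ_w)}) (w ↦ {1}) s` is multipliable on `Re s > 1` ((2.1),
`JacquetShalika1981_multipliable_partialPairL_repData_holds`), continuous and non-zero at every point
of `Re s > 1` (`continuousAt_and_ne_zero_partialPairL_repData`), has a simple pole at `s = 1` with
non-zero residue when `u(ϖ_w) = 1` for almost all `w` (then, `S₀` containing the exceptional places,
`L^S(s, u) = ζ_F^S(s)`: Hecke, `tendsto_sub_one_mul_partialPairL_one_one`), and a finite non-zero
limit as `s → 1`, `Re s > 1` otherwise ((2.2) in ranks `(1, 1)`, the theorem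
`JacquetShalika1981_partialPairL_boundary_repData_one_one`, whose exceptional clause
`q_w^{1-1} u(ϖ_w) = 1⁻¹` a.e. is `u(ϖ_w) = 1` a.e.).
[cite: ArthurClozelAMS120, Ch. 3 §2 (2.1)–(2.3)] [cite: NeukirchANT1999, Ch. VII Cor. (5.11) (ii)] -/
theorem analyticPackage_glOne (F : Type) [Field F] [NumberField F] (u : HeckeCharacter F)
    (hu : ∀ᶠ w : HeightOneSpectrum (𝓞 F) in cofinite, ‖u.valueAtUniformizer w‖ = 1) :
    ∃ S₀ : Set (HeightOneSpectrum (𝓞 F)), S₀.Finite ∧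
      ∀ (S : Set (HeightOneSpectrum (𝓞 F))), S.Finite → S₀ ⊆ S →
        (∀ s : ℂ, 1 < s.re → Multipliable fun v : {v : HeightOneSpectrum (𝓞 F) // v ∉ S} =>
          ((satakePairPolynomial {u.valueAtUniformizer v.1} {1}).eval
            ((v.1.residueCard : ℂ) ^ (-s)))⁻¹) ∧
        (∀ s : ℂ, 1 < s.re →
          ContinuousAt (partialPairL S (fun w => {u.valueAtUniformizer w}) (fun _ => {1})) s ∧
            partialPairL S (fun w => {u.valueAtUniformizer w}) (fun _ => {1}) s ≠ 0) ∧
        ((∀ᶠ w : HeightOneSpectrum (𝓞 F) in cofinite, u.valueAtUniformizer w = 1) →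
          ∃ c : ℂ, c ≠ 0 ∧ Tendsto
            (fun s : ℂ => (s - 1) *
              partialPairL S (fun w => {u.valueAtUniformizer w}) (fun _ => {1}) s)
            (𝓝[{s : ℂ | 1 < s.re}] 1) (𝓝 c)) ∧
        ((¬ ∀ᶠ w : HeightOneSpectrum (𝓞 F) in cofinite, u.valueAtUniformizer w = 1) →
          ∃ c : ℂ, c ≠ 0 ∧
            Tendsto (partialPairL S (fun w => {u.valueAtUniformizer w}) (fun _ => {1}))
              (𝓝[{s : ℂ | 1 < s.re}] 1) (𝓝 c)) := by
  have h1 : isCompact_glFiniteIntegralLevel 1 F := isCompact_glFiniteIntegralLevel_holds 1 F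
  -- the `GL₁` data of `u` and of the trivial character, (2.1) and the interior package
  obtain ⟨τ, hτ⟩ := exists_cuspidal_glOne_hasSatakeParamAt_valueAtUniformizer h1 u
  obtain ⟨τ₀, hτ₀⟩ := exists_cuspidal_glOne_hasSatakeParamAt_one h1
  obtain ⟨S₁, hS₁, hJ1a⟩ := JacquetShalika1981_multipliable_partialPairL_repData_holds 1 1 F h1 h1
    one_pos one_pos τ τ₀
  obtain ⟨S₂, hS₂, hIa⟩ := continuousAt_and_ne_zero_partialPairL_repData τ τ₀
  -- the good places
  have hgood : ∀ᶠ w : HeightOneSpectrum (𝓞 F) in cofinite,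
      τ.1.HasSatakeParamAt w {u.valueAtUniformizer w} ∧ τ₀.1.HasSatakeParamAt w {1} ∧
        ‖u.valueAtUniformizer w‖ = 1 := by
    filter_upwards [hτ, hτ₀, hu] with w h₁ h₂ h₃
    exact ⟨h₁, h₂, h₃⟩
  obtain ⟨T, hT, hgoodT⟩ : ∃ T : Set (HeightOneSpectrum (𝓞 F)), T.Finite ∧ ∀ w ∉ T,
      τ.1.HasSatakeParamAt w {u.valueAtUniformizer w} ∧ τ₀.1.HasSatakeParamAt w {1} ∧
        ‖u.valueAtUniformizer w‖ = 1 :=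
    ⟨_, Filter.eventually_cofinite.1 hgood, fun w hw => not_not.1 hw⟩
  -- the two boundary clauses: a simple pole iff `u(ϖ_w) = 1` a.e. (Hecke), else (2.2) on `GL₁ × GL₁`
  obtain ⟨E, hE, hbdry⟩ : ∃ E : Set (HeightOneSpectrum (𝓞 F)), E.Finite ∧
      ∀ {S : Set (HeightOneSpectrum (𝓞 F))}, S.Finite → E ⊆ S → T ⊆ S →
        ((∀ᶠ w : HeightOneSpectrum (𝓞 F) in cofinite, u.valueAtUniformizer w = 1) →
          ∃ c : ℂ, c ≠ 0 ∧ Tendsto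
            (fun s : ℂ => (s - 1) *
              partialPairL S (fun w => {u.valueAtUniformizer w}) (fun _ => {1}) s)
            (𝓝[{s : ℂ | 1 < s.re}] 1) (𝓝 c)) ∧
        ((¬ ∀ᶠ w : HeightOneSpectrum (𝓞 F) in cofinite, u.valueAtUniformizer w = 1) →
          ∃ c : ℂ, c ≠ 0 ∧
            Tendsto (partialPairL S (fun w => {u.valueAtUniformizer w}) (fun _ => {1}))
              (𝓝[{s : ℂ | 1 < s.re}] 1) (𝓝 c)) := by
    by_cases hX : ∀ᶠ w : HeightOneSpectrum (𝓞 F) in cofinite, u.valueAtUniformizer w = 1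
    · refine ⟨{w | ¬ u.valueAtUniformizer w = 1}, Filter.eventually_cofinite.1 hX,
        fun {S} hS hES _ => ⟨fun _ => ?_, fun h => absurd hX h⟩⟩
      -- off `S` the family is literally `{1}`: `L^S(s, u) = ζ_F^S(s)`
      have heq : partialPairL S (fun w => {u.valueAtUniformizer w}) (fun _ => {1}) =
          partialPairL S (fun _ => {1}) (fun _ => {1}) := by
        funext s
        unfold partialPairL
        congr 1
        funext v
        beta_reduce
        rw [show u.valueAtUniformizer v.1 = 1 from not_not.1 fun h => v.2 (hES h)]
      obtain ⟨c₀, hc₀, hZ⟩ := tendsto_sub_one_mul_partialPairL_one_one hS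
        (one := fun _ => ({1} : Multiset ℂ)) (fun _ => rfl)
      refine ⟨c₀, hc₀, ?_⟩
      rw [heq]
      exact hZ
    · obtain ⟨S₆, hS₆, hJ2b⟩ := JacquetShalika1981_partialPairL_boundary_repData_one_one h1 h1 τ τ₀
      refine ⟨S₆, hS₆, fun {S} hS h6S hTS => ⟨fun h => absurd h hX, fun _ => ?_⟩⟩
      have hTS' : ∀ w ∉ S, w ∉ T := fun w hw h => hw (hTS h)
      obtain ⟨c, hc, hL⟩ := hJ2b hS h6S
        (α := fun w => ({u.valueAtUniformizer w} : Multiset ℂ)) (β := fun _ => ({1} : Multiset ℂ))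
        (fun w hw => (hgoodT w (hTS' w hw)).1) (fun w hw => (hgoodT w (hTS' w hw)).2.1)
        (fun w hw => by
          show ‖({u.valueAtUniformizer w} : Multiset ℂ).prod‖ = 1
          rw [Multiset.prod_singleton]
          exact (hgoodT w (hTS' w hw)).2.2)
        (fun w _ => by
          show ‖({(1 : ℂ)} : Multiset ℂ).prod‖ = 1
          rw [Multiset.prod_singleton, norm_one])
        Complex.one_re
        (fun h => hX (h.2.mono fun w hw => by simpa [sub_self, Complex.cpow_zero] using hw))
      exact ⟨c, hc, hL⟩
  refine ⟨T ∪ S₁ ∪ S₂ ∪ E, ((hT.union hS₁).union hS₂).union hE, ?_⟩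
  intro S hS hS₀
  have subT : T ⊆ S := fun x hx => hS₀ (by simp [hx])
  have sub₁ : S₁ ⊆ S := fun x hx => hS₀ (by simp [hx])
  have sub₂ : S₂ ⊆ S := fun x hx => hS₀ (by simp [hx])
  have subE : E ⊆ S := fun x hx => hS₀ (by simp [hx])
  have hTS : ∀ w ∉ S, w ∉ T := fun w hw h => hw (subT h)
  have hτS : ∀ w ∉ S, τ.1.HasSatakeParamAt w
      ((fun w => ({u.valueAtUniformizer w} : Multiset ℂ)) w) :=
    fun w hw => (hgoodT w (hTS w hw)).1
  have hτ₀S : ∀ w ∉ S, τ₀.1.HasSatakeParamAt w ((fun _ => ({1} : Multiset ℂ)) w) :=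
    fun w hw => (hgoodT w (hTS w hw)).2.1
  have huS : ∀ w ∉ S, ‖((fun w => ({u.valueAtUniformizer w} : Multiset ℂ)) w).prod‖ = 1 :=
    fun w hw => by
    show ‖({u.valueAtUniformizer w} : Multiset ℂ).prod‖ = 1
    rw [Multiset.prod_singleton]
    exact (hgoodT w (hTS w hw)).2.2
  have huone : ∀ w ∉ S, ‖((fun _ => ({1} : Multiset ℂ)) w).prod‖ = 1 := fun w _ => by
    show ‖({(1 : ℂ)} : Multiset ℂ).prod‖ = 1
    rw [Multiset.prod_singleton, norm_one]
  obtain ⟨h3, h4⟩ := hbdry hS subE subT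
  exact ⟨fun s hs => hJ1a hS sub₁ hτS hτ₀S huS huone hs,
    fun s hs => hIa hS sub₂ hτS hτ₀S huS huone hs, h3, h4⟩

end Literature.NumberTheory.Automorphic

end
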